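import Summits.BirchSwinnertonDyer.BirchSwinnertonDyer.Theorems.QuadraticBranchSignedControlPlusEtaNonsurjThetaFunctionalEquationRootNumber
import Summits.BirchSwinnertonDyer.BirchSwinnertonDyer.Theorems.QuadraticBranchSignedControlPlusEtaNonsurjPlusCoeffCongruenceQuotient
import Summits.BirchSwinnertonDyer.BirchSwinnertonDyer.Theorems.QuadraticBranchSignedControlPlusEtaNonsurjMinusCoeffCongruenceWide
import HarnessLib

/-!
# Route `QuadraticBranchSignedControl` (rung K8, cell `bsd-potss`), residual crux `PlusEtaMainConjectureNonsurj`
# (stmt-BirchSwinnertonDyer-19606): THE FUNCTIONAL EQUATION ON THE QUADRATIC BRANCH, VIII — THE SIGN TEST OF A λ-CERTIFICATE: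
# a displayed symbol pattern certifying `λ^± = λ` (g24/g25/g26 readings) FORCES `(−1)^λ = σ·(−N | p)` (`= w_V·(−N_V|p) = w(W)`)
# (seat `bsd-potss-k8eta-c2` g27; kernel, record-facing; sequel of `…ThetaFunctionalEquationRootNumber`)

WHY. The lineage certifies `λ⁺` / `λ⁻` of rows by DISPLAYED exact-rational symbol valuations: the quotient reading (g26,
`EtaPlusCoeffCongruence.hasUnitContent_and_mu_lam_plus_of_quotient_padicNorm`: pattern of `ℓ_m = θ_{2m}(η)/ω⁻_{2m}` ⇒ `μ⁺ = 0 ∧ λ⁺ = λ`) and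
the wide minus reading (g25, `EtaMinusCoeffCongruence.hasUnitContent_and_mu_lam_minus_wide_of_padicNorm`: pattern of `θ_{2m+1}(η)` ⇒
`μ⁻ = 0 ∧ λ⁻ = λ`). Part V's parity law makes every such certificate TESTABLE against the sign: THIS FILE composes them — a displayed pattern
for `λ` of the wrong parity is CONTRADICTORY by name (it refutes the row's symbol data), and a pattern of the right parity yields
`σ·(−N | p) = (−1)^λ` from modular symbols alone; at the conductor level, `w_V·(−N_V | p) = (−1)^λ`. Census P-27S/S3 (k8eta-c2 g27): the
PARI λ's of all 9129 CM census rows pass the test.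

WHAT. §18 `neg_one_pow_eq_sign_of_quotient_padicNorm` (plus, level `2m ≥ 2`, `λ ≤ p(p−1)`), `neg_one_pow_eq_sign_of_theta_padicNorm_wide`
(minus, level `2m+1 ≥ 3`, `λ < p(p−1)`), and the conductor-level forms `…_eq_rootNumber_mul_legendreSym_…`.

HONEST FRAMING (cell `bsd-potss`; FULL-BSD rank ≤ 1 programme, HUMAN RULING D-0036/D-0074): TOOL THEOREMS ONLY — no definition, no named
fact minted, no `sorry`, axioms standard; nothing about (A), (C1⁺_η), C-cc-1 or `BSD(W,p)` of any pair is claimed; no stub of 19606 is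
proved; crux and route OPEN; nothing booked. `--supports stmt-BirchSwinnertonDyer-19606`.

References: [MazurTateTeitelbaum1986Invent] §I.17; [Kobayashi2003] Thm. 3.2, (3.4)–(3.7); [Pollack2003] Prop. 6.18; [Washington1997] §7.1.
Tree: Parts V, VII; `…PlusCoeffCongruenceQuotient.lean` (g26), `…MinusCoeffCongruenceWide.lean` (g25).
-/

set_option autoImplicit false
set_option linter.dupNamespace false
noncomputable section

open scoped Classical MatrixGroups ModularForm

open CongruenceSubgroup Polynomial WeierstrassCurve Literature.NumberTheory.EllipticCurves
  Literature.NumberTheory.EllipticCurves.ModularForms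
open Literature.NumberTheory.EllipticCurves.GreenbergVatsal2000 (HasUnitContent)
open Summit.BirchSwinnertonDyer.Rank1Residual.Additive
open Summit.BirchSwinnertonDyer.Rank1Residual.X1.MuLambda (lam)

namespace Summit.BirchSwinnertonDyer.BirchSwinnertonDyer.Theorems.EtaThetaFunctionalEquation

variable {p : ℕ} [hp : Fact p.Prime]

/-! ## §18 The sign test of a displayed λ-certificate -/

omit hp in
/-- A power series with unit content is nonzero. [folklore] -/
theorem ne_zero_of_hasUnitContent [Fact p.Prime] {L : PowerSeries ℤ_[p]} (h : HasUnitContent L) : L ≠ 0 := by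
  rintro rfl
  obtain ⟨n, hn⟩ := h
  rw [map_zero] at hn
  exact not_isUnit_zero hn

section Branch

variable {N : ℕ} [NeZero N] {f : CuspForm (Gamma0 N) 2}

/-- **THE SIGN TEST, PLUS SIDE.** `p` odd, `f` a rational newform of level `N` prime to `p` with `a_p(f) = 0` and Fricke sign `σ`,
`‖ϖ‖_p ≤ 1`, `L` a plus branch function, `m ≥ 1`, `λ ≤ p(p−1)`; DISPLAYED (g26's quotient pattern): `‖ϖ·coeff_jℓ_m‖_p ≤ p⁻¹` for `j < λ` and
`‖ϖ·coeff_λℓ_m‖_p = 1` (`ℓ_m = θ_{2m}(η)/ω⁻_{2m}`). CONCLUSION: `(−1)^λ = σ·(−N | p)`. [cite: MazurTateTeitelbaum1986Invent, §I.17]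
[cite: Pollack2003, Prop. 6.18] -/
theorem neg_one_pow_eq_sign_of_quotient_padicNorm (hp2 : p ≠ 2) (hf0 : IsNewform0 f) (hQ : coeffField f = ⊥)
    (hpN : ¬ p ∣ N) (hap : cuspCoeff f p = ((0 : ℤ) : ℂ)) {σ : ℤ} (hσ : σ ^ 2 = 1)
    (hW : atkinLehnerInvolution N 2 N f = (-(σ : ℂ)) • f) {ϖ : ℚ} (hϖ : ‖(ϖ : ℚ_[p])‖ ≤ 1)
    {L : IwasawaAlgebra p} (hL : IsQuadraticBranchPlusLFunction f p ϖ L) (m : ℕ) (hm : 1 ≤ m) {lam : ℕ}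
    (hlam : lam ≤ p * (p - 1))
    (hlow : ∀ j < lam, ‖(ϖ : ℚ_[p]) * (((quadraticBranchMazurTateElement p f (2 * m) /ₘ
        (cyclotomicOmegaMinus p (2 * m)).map (Int.castRingHom ℚ)).coeff j : ℚ) : ℚ_[p])‖ ≤ (p : ℝ)⁻¹)
    (htop : ‖(ϖ : ℚ_[p]) * (((quadraticBranchMazurTateElement p f (2 * m) /ₘ
        (cyclotomicOmegaMinus p (2 * m)).map (Int.castRingHom ℚ)).coeff lam : ℚ) : ℚ_[p])‖ = 1) :
    (-1 : ℤ) ^ lam = σ * legendreSym p (-(N : ℤ)) := by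
  obtain ⟨hu, -, hl, -⟩ := EtaPlusCoeffCongruence.hasUnitContent_and_mu_lam_plus_of_quotient_padicNorm hp2 hf0 hQ hpN hap hϖ hL m hm
    hlam hlow htop
  rw [← hl]
  exact neg_one_pow_lam_eq_sign_of_isQuadraticBranchPlusLFunction hp2 hf0 hQ hpN hap hσ hW hϖ hL (ne_zero_of_hasUnitContent hu)

/-- **THE SIGN TEST, MINUS SIDE** (g25's wide reading at level `2m+1 ≥ 3`, `λ < p(p−1)`): DISPLAYED `‖ϖ·coeff_jθ_{2m+1}(η)‖_p ≤ p^{−(m+1)}`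
for `1 ≤ j < λ` and `‖ϖ·coeff_λθ_{2m+1}(η)‖_p = p^{−m}`. CONCLUSION: `(−1)^λ = σ·(−N | p)`. [cite: MazurTateTeitelbaum1986Invent, §I.17]
[cite: Pollack2003, Prop. 6.18] -/
theorem neg_one_pow_eq_sign_of_theta_padicNorm_wide (hp2 : p ≠ 2) (hf0 : IsNewform0 f) (hQ : coeffField f = ⊥)
    (hpN : ¬ p ∣ N) (hap : cuspCoeff f p = ((0 : ℤ) : ℂ)) {σ : ℤ} (hσ : σ ^ 2 = 1)
    (hW : atkinLehnerInvolution N 2 N f = (-(σ : ℂ)) • f) {ϖ : ℚ} (hϖ : ‖(ϖ : ℚ_[p])‖ ≤ 1)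
    {L : IwasawaAlgebra p} (hL : IsQuadraticBranchMinusLFunction f p ϖ L) (m : ℕ) (hm : 1 ≤ m) {lam : ℕ}
    (hlam : lam < p * (p - 1))
    (hlow : ∀ j, 1 ≤ j → j < lam →
      ‖(ϖ : ℚ_[p]) * (((quadraticBranchMazurTateElement p f (2 * m + 1)).coeff j : ℚ) : ℚ_[p])‖ ≤ ((p : ℝ)⁻¹) ^ (m + 1))
    (htop : ‖(ϖ : ℚ_[p]) * (((quadraticBranchMazurTateElement p f (2 * m + 1)).coeff lam : ℚ) : ℚ_[p])‖ = ((p : ℝ)⁻¹) ^ m) :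
    (-1 : ℤ) ^ lam = σ * legendreSym p (-(N : ℤ)) := by
  obtain ⟨hu, -, hl, -⟩ := EtaMinusCoeffCongruence.hasUnitContent_and_mu_lam_minus_wide_of_padicNorm hp2 hf0 hQ hpN hap hϖ hL m hm
    hlam hlow htop
  rw [← hl]
  exact neg_one_pow_lam_eq_sign_of_isQuadraticBranchMinusLFunction hp2 hf0 hQ hpN hap hσ hW hϖ hL (ne_zero_of_hasUnitContent hu)

end Branch

section Root

variable {V : WeierstrassCurve ℚ} [V.IsElliptic] [NeZero (V.conductorNorm ℤ)] [V.IsGloballyMinimal]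
  {f : CuspForm (Gamma0 (V.conductorNorm ℤ)) 2}

/-- **THE SIGN TEST AT A ROW, conductor level, plus side**: `V` good at `p ≥ 5` with `a_p(V) = 0`, `f` its newform at level `N_V`, Mazur's
`hM`, any period ratio `ϖ`, any plus branch function; the displayed quotient pattern for `λ` (`m ≥ 1`, `λ ≤ p(p−1)`) gives
`(−1)^λ = w_V·(−N_V | p)`. [cite: MazurTateTeitelbaum1986Invent, §I.17] [cite: Pollack2003, Prop. 6.18] [cite: Mazur1978, Cor. 4.1] -/
theorem neg_one_pow_eq_rootNumber_mul_legendreSym_of_quotient_padicNorm (hM : mazur_not_dvd_maninConstant_of_odd) (hp5 : 5 ≤ p)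
    (hgood : V.HasGoodReductionAtPrime p) (hap : V.frobeniusTrace p = 0) (hf : IsNewformOf V f) (ϖ : ℚ)
    (hrel : if Even (p / 2) then (ϖ : ℝ) * V.realPeriodRat = plusPeriod f
      else (ϖ : ℝ) * V.imaginaryPeriodRat = minusPeriod f)
    {Lη : IwasawaAlgebra p} (hL : IsQuadraticBranchPlusLFunction f p ϖ Lη) (m : ℕ) (hm : 1 ≤ m) {lam : ℕ}
    (hlam : lam ≤ p * (p - 1))
    (hlow : ∀ j < lam, ‖(ϖ : ℚ_[p]) * (((quadraticBranchMazurTateElement p f (2 * m) /ₘ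
        (cyclotomicOmegaMinus p (2 * m)).map (Int.castRingHom ℚ)).coeff j : ℚ) : ℚ_[p])‖ ≤ (p : ℝ)⁻¹)
    (htop : ‖(ϖ : ℚ_[p]) * (((quadraticBranchMazurTateElement p f (2 * m) /ₘ
        (cyclotomicOmegaMinus p (2 * m)).map (Int.castRingHom ℚ)).coeff lam : ℚ) : ℚ_[p])‖ = 1) :
    (-1 : ℤ) ^ lam = V.rootNumber * legendreSym p (-(V.conductorNorm ℤ : ℤ)) := by
  have hp2 : p ≠ 2 := by omega
  have hap' : cuspCoeff f p = ((0 : ℤ) : ℂ) := by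
    rw [cuspCoeff_eq_frobeniusTrace_of_isNewformOf_holds hf hgood, hap]
  exact neg_one_pow_eq_sign_of_quotient_padicNorm hp2 hf.1 hf.coeffField_eq_bot (not_dvd_level_of_isNewformOf hf hgood) hap'
    rootNumber_sq_eq_one (atkinLehnerInvolution_eq_neg_rootNumber_smul hf)
    (EtaMinusCoeffCongruence.norm_periodRatio_le_one_of_mazur p hM hp5 V f hf hgood hap ϖ hrel) hL m hm hlam hlow htop

/-- **THE SIGN TEST AT A ROW, conductor level, minus side** (wide reading, `m ≥ 1`, `λ < p(p−1)`): `(−1)^λ = w_V·(−N_V | p)`.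
[cite: MazurTateTeitelbaum1986Invent, §I.17] [cite: Pollack2003, Prop. 6.18] [cite: Mazur1978, Cor. 4.1] -/
theorem neg_one_pow_eq_rootNumber_mul_legendreSym_of_theta_padicNorm_wide (hM : mazur_not_dvd_maninConstant_of_odd) (hp5 : 5 ≤ p)
    (hgood : V.HasGoodReductionAtPrime p) (hap : V.frobeniusTrace p = 0) (hf : IsNewformOf V f) (ϖ : ℚ)
    (hrel : if Even (p / 2) then (ϖ : ℝ) * V.realPeriodRat = plusPeriod f
      else (ϖ : ℝ) * V.imaginaryPeriodRat = minusPeriod f)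
    {Lη : IwasawaAlgebra p} (hL : IsQuadraticBranchMinusLFunction f p ϖ Lη) (m : ℕ) (hm : 1 ≤ m) {lam : ℕ}
    (hlam : lam < p * (p - 1))
    (hlow : ∀ j, 1 ≤ j → j < lam →
      ‖(ϖ : ℚ_[p]) * (((quadraticBranchMazurTateElement p f (2 * m + 1)).coeff j : ℚ) : ℚ_[p])‖ ≤ ((p : ℝ)⁻¹) ^ (m + 1))
    (htop : ‖(ϖ : ℚ_[p]) * (((quadraticBranchMazurTateElement p f (2 * m + 1)).coeff lam : ℚ) : ℚ_[p])‖ = ((p : ℝ)⁻¹) ^ m) :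
    (-1 : ℤ) ^ lam = V.rootNumber * legendreSym p (-(V.conductorNorm ℤ : ℤ)) := by
  have hp2 : p ≠ 2 := by omega
  have hap' : cuspCoeff f p = ((0 : ℤ) : ℂ) := by
    rw [cuspCoeff_eq_frobeniusTrace_of_isNewformOf_holds hf hgood, hap]
  exact neg_one_pow_eq_sign_of_theta_padicNorm_wide hp2 hf.1 hf.coeffField_eq_bot (not_dvd_level_of_isNewformOf hf hgood) hap'
    rootNumber_sq_eq_one (atkinLehnerInvolution_eq_neg_rootNumber_smul hf)
    (EtaMinusCoeffCongruence.norm_periodRatio_le_one_of_mazur p hM hp5 V f hf hgood hap ϖ hrel) hL m hm hlam hlow htop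

end Root

end Summit.BirchSwinnertonDyer.BirchSwinnertonDyer.Theorems.EtaThetaFunctionalEquation

end
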